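import Summits.AtomisticToContinuum.Crystallization.Theorems.HolmgrenBoyleLindFLCEquilibriumPeriodic
import Summits.AtomisticToContinuum.Crystallization.Theorems.HolmgrenBoyleLindHalfSpaceRigidityPeriodic

/-!
# `FLCEquilibriumPeriodic ↔ HalfSpaceUniqueContinuation` (route `HolmgrenBoyleLind`), unconditionally

Support file for item stmt-AtomisticToContinuum-6079 (`FLCEquilibriumPeriodic`). With the
half-space rigidity theorem `HalfSpaceRigidityPeriodic` (item 6077) now PROVED in the tree
(`holmgrenBoyleLind_halfSpaceRigidityPeriodic_proof`, file
`HolmgrenBoyleLindHalfSpaceRigidityPeriodic.lean`), the equivalence of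
`HolmgrenBoyleLindFLCEquilibriumPeriodic.lean` becomes unconditional:

* `flcEquilibriumPeriodic_of_uc` — `HalfSpaceUniqueContinuation → FLCEquilibriumPeriodic`: item 6079
  closes by this one-liner the moment the crux `HalfSpaceUniqueContinuation_holds` (item 6075) lands;
* `flcEquilibriumPeriodic_iff_uc` — `FLCEquilibriumPeriodic ↔ HalfSpaceUniqueContinuation`: the
  support item 6079 and the crux 6075 are the same theorem ("every FLC Delone Lennard-Jones
  equilibrium of `ℝ³` is a periodic crystal" ⇔ "unique continuation across half-spaces in the
  patch-hull of an FLC Delone Lennard-Jones equilibrium").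

Pure logic over landed theorems; nothing here closes an item.
-/

namespace Summit.AtomisticToContinuum.Crystallization.Theorems

open Summit.AtomisticToContinuum.Crystallization.Theses.HolmgrenBoyleLind

/-- `HalfSpaceUniqueContinuation → FLCEquilibriumPeriodic` (crux 6075 ⇒ item 6079), by the route glue
and the proved half-space rigidity theorem (item 6077). [folklore] -/
theorem flcEquilibriumPeriodic_of_uc (hUC : HalfSpaceUniqueContinuation) : FLCEquilibriumPeriodic :=
  flcEquilibriumPeriodic_of_uc_of_hsr hUC holmgrenBoyleLind_halfSpaceRigidityPeriodic_proof

/-- **`FLCEquilibriumPeriodic ↔ HalfSpaceUniqueContinuation`** (item 6079 ⇔ crux 6075),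
unconditionally. [folklore] -/
theorem flcEquilibriumPeriodic_iff_uc : FLCEquilibriumPeriodic ↔ HalfSpaceUniqueContinuation :=
  flcEquilibriumPeriodic_iff_halfSpaceUniqueContinuation holmgrenBoyleLind_halfSpaceRigidityPeriodic_proof

end Summit.AtomisticToContinuum.Crystallization.Theorems
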